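import Mathlib.Analysis.SpecialFunctions.Integrals.Basic
import Mathlib.Analysis.SpecialFunctions.Pow.Real
import Mathlib.MeasureTheory.Integral.IntervalIntegral.IntegrationByParts
import HarnessLib

/-!
# Wei 2016, Lemma 2.3: the one-dimensional Hardy-type inequality along a ray

Analysis/FluidPDE proof file (theorems only) on the way to
`Literature.Analysis.FluidPDE.Wei2016_logModulus_regularity`
(`LeiZhang2017AxisymmetricCriteria.lean`), after

* D. Wei, *Regularity criterion to the axially symmetric Navier–Stokes equations*, J. Math. Anal.
  Appl. 435 (2016) 402–413 = arXiv:1508.03318, §2, Lemma 2.3 and its proof, displays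
  (2.5)–(2.8).

Lemma 2.3 is the paper's "new important observation": if `‖Γ‖_{L^∞(r ≤ r₁)} ≤ ε ≤ 1` and
`0 < r₁ ≤ εK(ε)/a(t)`, `a(t) = ‖v/r‖_{L^∞}`, `v(r, z, t) = ∫₀ʳ |u_θ(r', z, t)| dr'`, then
`∫ (|u_θ|/r) |f|² dx ≤ ε^{-1/3} ∫ |∂ᵣf|² dx + (lower order)` for axially symmetric `f ∈ H¹`. Its
core is the case `f = 0` for `r ≥ r₁`, display (2.5), proved ray by ray (`z` fixed,
`dx = r dr dθ dz`):

> `|f(r', z)|² ≤ ∫_{r'}^{r₁} r|∂ᵣf|² dr · ∫_{r'}^{r₁} dr/r` (Hölder), hence (2.6)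
> `∫ |u_θ(r')| |f(r')|² dr' ≤ ∫ r|∂ᵣf|² dr · ∫₀^{r₁} |u_θ(r')| ∫_{r'}^{r₁} dr/r dr'`; (2.7)
> `∫₀^{r₁} |u_θ(r')| ∫_{r'}^{r₁} dr/r dr' = ∫₀^{r₁} v(r) dr/r`; `v ≤ r a(t)`, `|u_θ| ≤ ε/r` on
> `(0, r₁)`, so `v(r) ≤ ε(1 + ln(ra(t)/ε))` for `ε/a(t) ≤ r ≤ r₁`, and (2.8)
> `∫₀^{r₁} v dr/r ≤ ∫₀^{ε/a} a dr + ∫_{ε/a}^{εK/a} ε(1 + ln(ra/ε)) dr/r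
>   = ε(1 + ln K + ½ (ln K)²) = ε^{-1/3}`.

This file proves exactly this chain for real functions of one variable `r` (the profile of
`|u_θ|` and of `f` along a ray), with the constant kept in the general form
`ε(1 + ln K + ½ (ln K)²)` for any `K ≥ 1` with `r₁ ≤ εK/a` (the specialisation to Wei's
`K(ε)`, where `1 + ln K + ½ (ln K)² = ε^{-4/3}` — `Wei2016.one_add_log_K_add_sq_div_two` of
`Wei2016SwirlCriterionProofs.lean` — gives the printed `ε^{-1/3}`):

* `Wei2016.sq_le_integral_mul_log` — the Hölder step `|f(r')|² ≤ ∫_{r'}^{r₁} r|f'|² · ln(r₁/r')`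
  (run as `2|f'| ≤ λ r f'² + (λr)⁻¹`, integrated, optimised in `λ`:
  `Wei2016.sq_le_mul_of_forall_two_mul_le`);
* `Wei2016.integral_mul_log_le_integral_primitive_mul_inv` — (2.7) in the form
  `∫_δ^{r₁} w ln(r₁/r) ≤ ∫_δ^{r₁} v(r)/r` for `0 < δ ≤ r₁` (integration by parts, the boundary
  term `−v(δ) ln(r₁/δ) ≤ 0` dropped; the paper's Fubini identity is only needed as this
  inequality);
* `Wei2016.integral_primitive_mul_inv_le` — (2.8): `∫_δ^{r₁} v(r)/r ≤ ε(1 + ln K + ½ (ln K)²)`;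
* `Wei2016.integral_mul_sq_le_hardy` — (2.5)–(2.6) assembled on `[δ, r₁]` and `δ → 0⁺`:
  `∫₀^{r₁} w f² ≤ ε(1 + ln K + ½ (ln K)²) ∫₀^{r₁} r f'²`.

Hypotheses are those of the application (profiles of smooth fields along a ray): `w = |u_θ|`
continuous and nonnegative on `ℝ`, `f` everywhere differentiable with continuous derivative,
`f(r₁) = 0`; the two structural bounds `w ≤ ε/r` and `∫₀ʳ w ≤ r a` are assumed on `(0, r₁]`
only.

## Mathlib search

Mathlib has Hardy's inequality neither in this logarithmic endpoint form nor in the classical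
form (`lean search 'hardy_ineq|Hardy'` in `Mathlib/Analysis`: none relevant); used:
`integral_inv_of_pos` (`∫ dr/r = ln`), `intervalIntegral.integral_mul_deriv_eq_deriv_mul`
(integration by parts), `intervalIntegral.integral_eq_sub_of_hasDerivAt`,
`intervalIntegral.integral_mono_on`, `intervalIntegral.integral_mono_interval`,
`intervalIntegral.continuous_primitive`, `Continuous.integral_hasStrictDerivAt`.

## References

* D. Wei, J. Math. Anal. Appl. 435 (2016) 402–413, arXiv:1508.03318, Lemma 2.3, proof,
  (2.5)–(2.8). [Wei2016]
-/

noncomputable section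

open MeasureTheory Set Filter Topology intervalIntegral

namespace Literature.Analysis.FluidPDE

namespace Wei2016

/-! ### Two elementary inequalities -/

/-- Optimisation in `λ` of the family `2I ≤ λA + B/λ` (`λ > 0`, `I, A, B ≥ 0`): `I² ≤ AB`
(the Cauchy–Schwarz/Hölder step of (2.6) in elementary form). [folklore] -/
theorem sq_le_mul_of_forall_two_mul_le {I A B : ℝ} (hI : 0 ≤ I) (hA : 0 ≤ A) (hB : 0 ≤ B)
    (h : ∀ l : ℝ, 0 < l → 2 * I ≤ l * A + B / l) : I ^ 2 ≤ A * B := by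
  rcases hA.eq_or_lt with hA0 | hApos
  · -- `A = 0`: `2I ≤ B/λ` for all `λ`, so `I = 0`
    have hI0 : I = 0 := by
      by_contra hne
      have hIpos : 0 < I := lt_of_le_of_ne hI (Ne.symm hne)
      have h1 := h ((B + 1) / I) (by positivity)
      rw [← hA0, mul_zero, zero_add, div_div_eq_mul_div, le_div_iff₀ (by positivity)] at h1
      nlinarith
    rw [hI0, ← hA0]
    simp
  rcases hB.eq_or_lt with hB0 | hBpos
  · -- `B = 0`: `2I ≤ λA` for all `λ`, so `I = 0`
    have hI0 : I = 0 := by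
      by_contra hne
      have hIpos : 0 < I := lt_of_le_of_ne hI (Ne.symm hne)
      have h1 := h (I / (A + 1)) (by positivity)
      rw [← hB0, zero_div, add_zero, div_mul_eq_mul_div, le_div_iff₀ (by positivity)] at h1
      nlinarith
    rw [hI0, ← hB0]
    simp
  -- `A, B > 0`: `λ = √B/√A`
  set sA := Real.sqrt A with hsA
  set sB := Real.sqrt B with hsB
  have hsA0 : 0 < sA := Real.sqrt_pos.2 hApos
  have hsB0 : 0 < sB := Real.sqrt_pos.2 hBpos
  have hsA2 : sA ^ 2 = A := Real.sq_sqrt hA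
  have hsB2 : sB ^ 2 = B := Real.sq_sqrt hB
  have hl := h (sB / sA) (by positivity)
  have e1 : sB / sA * A = sA * sB := by
    rw [← hsA2]
    field_simp
  have e2 : B / (sB / sA) = sA * sB := by
    rw [← hsB2]
    field_simp
  rw [e1, e2] at hl
  have hI' : I ≤ sA * sB := by linarith
  calc I ^ 2 ≤ (sA * sB) ^ 2 := pow_le_pow_left₀ hI hI' 2
    _ = A * B := by rw [mul_pow, hsA2, hsB2]

/-- `2|x| ≤ y x² + 1/y` for `y > 0` (`(y|x| − 1)² ≥ 0`). [folklore] -/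
theorem two_mul_abs_le {x y : ℝ} (hy : 0 < y) : 2 * |x| ≤ y * x ^ 2 + 1 / y := by
  have key : 2 * |x| * y ≤ (y * x ^ 2 + 1 / y) * y := by
    have e : (y * x ^ 2 + 1 / y) * y = (y * |x| - 1) ^ 2 + 2 * |x| * y := by
      rw [← sq_abs x]
      field_simp
      ring
    rw [e]
    nlinarith [sq_nonneg (y * |x| - 1)]
  exact le_of_mul_le_mul_right key hy

/-! ### The Hölder step: `|f(r')|² ≤ ∫_{r'}^{r₁} r |f'|² dr · ln(r₁/r')` -/

/-- **The pointwise bound of the proof of Lemma 2.3**: if `f` is differentiable with continuous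
derivative and `f(r₁) = 0`, then for `0 < r' ≤ r₁`,
`|f(r')|² ≤ ∫_{r'}^{r₁} r|f'(r)|² dr · ∫_{r'}^{r₁} dr/r = ∫_{r'}^{r₁} r|f'|² · ln(r₁/r')`
("`f(r', z) = −∫_{r'}^{r₁} ∂ᵣf(r, z) dr` for `0 < r' < r₁`, by Hölder inequality we have …").
Proof without `L²` machinery: `2|f'| ≤ λ r f'² + (λ r)⁻¹` pointwise (`two_mul_abs_le`),
integrate and optimise in `λ > 0` (`sq_le_mul_of_forall_two_mul_le`).
[cite: Wei2016, proof of Lemma 2.3 (display before (2.6))] -/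
theorem sq_le_integral_mul_log {f f' : ℝ → ℝ} {r' r₁ : ℝ} (hr' : 0 < r') (hr'r₁ : r' ≤ r₁)
    (hf : ∀ r, HasDerivAt f (f' r) r) (hf' : Continuous f') (hfr₁ : f r₁ = 0) :
    f r' ^ 2 ≤ (∫ r in r'..r₁, r * f' r ^ 2) * Real.log (r₁ / r') := by
  have hr₁ : 0 < r₁ := hr'.trans_le hr'r₁
  set I : ℝ := ∫ r in r'..r₁, |f' r| with hIdef
  set A : ℝ := ∫ r in r'..r₁, r * f' r ^ 2 with hAdef
  have hpos : ∀ r ∈ uIcc r' r₁, 0 < r := fun r hr => by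
    rw [uIcc_of_le hr'r₁] at hr
    exact hr'.trans_le hr.1
  have hBint : ∫ r in r'..r₁, r⁻¹ = Real.log (r₁ / r') := integral_inv_of_pos hr' hr₁
  have hI0 : 0 ≤ I := intervalIntegral.integral_nonneg hr'r₁ fun r _ => abs_nonneg _
  have hA0 : 0 ≤ A := intervalIntegral.integral_nonneg hr'r₁ fun r hr => by
    have : 0 ≤ r := hr'.le.trans hr.1
    positivity
  have hB0 : 0 ≤ Real.log (r₁ / r') := Real.log_nonneg ((one_le_div hr').2 hr'r₁)
  -- `f r' = -(∫ f')`, so `|f r'| ≤ I`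
  have hftc : ∫ r in r'..r₁, f' r = f r₁ - f r' :=
    integral_eq_sub_of_hasDerivAt (fun r _ => hf r) (hf'.intervalIntegrable _ _)
  have hfI : |f r'| ≤ I := by
    have e : f r' = -(∫ r in r'..r₁, f' r) := by
      rw [hftc, hfr₁]
      ring
    rw [e, abs_neg]
    exact abs_integral_le_integral_abs hr'r₁
  -- integrability on `[r', r₁]`
  have hinv : IntervalIntegrable (fun r : ℝ => r⁻¹) volume r' r₁ :=
    intervalIntegrable_inv (fun r hr => (hpos r hr).ne') continuousOn_id
  have hsq : IntervalIntegrable (fun r : ℝ => r * f' r ^ 2) volume r' r₁ :=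
    (continuous_id.mul (hf'.pow 2)).intervalIntegrable _ _
  -- the family of inequalities `2I ≤ λA + B/λ`
  have hkey : ∀ l : ℝ, 0 < l → 2 * I ≤ l * A + Real.log (r₁ / r') / l := by
    intro l hl
    have h1 : ∫ r in r'..r₁, 2 * |f' r| ≤ ∫ r in r'..r₁, (l * (r * f' r ^ 2) + r⁻¹ / l) := by
      refine integral_mono_on hr'r₁ ?_ ?_ fun r hr => ?_
      · exact (hf'.abs.const_mul 2).intervalIntegrable _ _
      · exact (hsq.const_mul l).add (hinv.div_const l)
      · have hr0 : 0 < r := hr'.trans_le hr.1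
        have h := two_mul_abs_le (x := f' r) (mul_pos hl hr0)
        calc 2 * |f' r| ≤ l * r * f' r ^ 2 + 1 / (l * r) := h
          _ = l * (r * f' r ^ 2) + r⁻¹ / l := by
              field_simp
    rw [intervalIntegral.integral_const_mul, intervalIntegral.integral_add (hsq.const_mul l)
      (hinv.div_const l), intervalIntegral.integral_const_mul, intervalIntegral.integral_div,
      hBint] at h1
    exact h1
  have hIsq : I ^ 2 ≤ A * Real.log (r₁ / r') := sq_le_mul_of_forall_two_mul_le hI0 hA0 hB0 hkey
  calc f r' ^ 2 = |f r'| ^ 2 := (sq_abs _).symm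
    _ ≤ I ^ 2 := pow_le_pow_left₀ (abs_nonneg _) hfI 2
    _ ≤ A * Real.log (r₁ / r') := hIsq

/-! ### (2.7): `∫ w(r') ∫_{r'}^{r₁} dr/r dr' ≤ ∫ v(r)/r dr` on `[δ, r₁]` -/

/-- **(2.7) as an inequality on `[δ, r₁]`, `0 < δ ≤ r₁`**: for continuous `w ≥ 0` with primitive
`v(r) = ∫₀ʳ w`, `∫_δ^{r₁} w(r) ln(r₁/r) dr ≤ ∫_δ^{r₁} v(r)/r dr`. The paper's identity
`∫₀^{r₁} |u_θ(r')| ∫_{r'}^{r₁} dr/r dr' = ∫₀^{r₁} v(r) dr/r` (Fubini) is obtained here by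
integrating by parts (`v' = w`, `(ln(r₁/r))' = −1/r`): the boundary term is
`−v(δ) ln(r₁/δ) ≤ 0`. [cite: Wei2016, proof of Lemma 2.3, (2.7)] -/
theorem integral_mul_log_le_integral_primitive_mul_inv {w : ℝ → ℝ} {δ r₁ : ℝ} (hδ : 0 < δ)
    (hδr₁ : δ ≤ r₁) (hw : Continuous w) (hw0 : ∀ r, 0 ≤ w r) :
    ∫ r in δ..r₁, w r * Real.log (r₁ / r) ≤ ∫ r in δ..r₁, (∫ s in (0 : ℝ)..r, w s) * r⁻¹ := by
  have hr₁ : 0 < r₁ := hδ.trans_le hδr₁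
  set V : ℝ → ℝ := fun r => ∫ s in (0 : ℝ)..r, w s with hVdef
  set L : ℝ → ℝ := fun r => Real.log r₁ - Real.log r with hLdef
  have hpos : ∀ r ∈ uIcc δ r₁, 0 < r := fun r hr => by
    rw [uIcc_of_le hδr₁] at hr
    exact hδ.trans_le hr.1
  have hL : ∀ r ∈ uIcc δ r₁, HasDerivAt L (-r⁻¹) r := fun r hr => by
    have h := (Real.hasDerivAt_log (hpos r hr).ne').const_sub (Real.log r₁)
    simpa [hLdef] using h
  have hVd : ∀ r ∈ uIcc δ r₁, HasDerivAt V (w r) r := fun r _ =>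
    (hw.integral_hasStrictDerivAt 0 r).hasDerivAt
  have hinv : IntervalIntegrable (fun r : ℝ => -r⁻¹) volume δ r₁ :=
    (intervalIntegrable_inv (fun r hr => (hpos r hr).ne') continuousOn_id).neg
  have hibp := integral_mul_deriv_eq_deriv_mul hL hVd hinv (hw.intervalIntegrable _ _)
  have hLr₁ : L r₁ = 0 := sub_self _
  have hLδ : 0 ≤ L δ := sub_nonneg.2 (Real.log_le_log hδ hδr₁)
  have hVδ : 0 ≤ V δ := intervalIntegral.integral_nonneg hδ.le fun s _ => hw0 s
  have hcongr : ∫ r in δ..r₁, w r * Real.log (r₁ / r) = ∫ r in δ..r₁, L r * w r := by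
    refine integral_congr fun r hr => ?_
    simp only [hLdef]
    rw [Real.log_div hr₁.ne' (hpos r hr).ne']
    ring
  have e : ∫ r in δ..r₁, -r⁻¹ * V r = -∫ r in δ..r₁, V r * r⁻¹ := by
    rw [← intervalIntegral.integral_neg]
    refine integral_congr fun r _ => ?_
    ring
  rw [hcongr, hibp, hLr₁, zero_mul, zero_sub, e]
  nlinarith [mul_nonneg hLδ hVδ]

/-! ### (2.8): `∫ v(r)/r dr ≤ ε(1 + ln K + ½ (ln K)²)` -/

/-- **The bound on `v` past `ε/a`**: if `w ≤ ε/r` and `∫₀ʳ w ≤ r a` on `(0, r₁]`, then for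
`ε/a ≤ r ≤ r₁`, `v(r) = v(ε/a) + ∫_{ε/a}^r w ≤ ε + ε ln(ra/ε) = ε(1 + ln r − ln(ε/a))`
("Hence, if `ε/a(t) ≤ r ≤ r₁`, then `v(r, z, t) ≤ ε(1 + ln(ra(t)/ε))`").
[cite: Wei2016, proof of Lemma 2.3 (display before (2.8))] -/
theorem primitive_le_of_le_div {w : ℝ → ℝ} {r r₁ ε a : ℝ} (hε : 0 < ε) (ha : 0 < a)
    (hw : Continuous w) (hwε : ∀ r ∈ Ioc 0 r₁, w r ≤ ε / r)
    (hV : ∀ r ∈ Ioc 0 r₁, ∫ s in (0 : ℝ)..r, w s ≤ r * a) (hr : ε / a ≤ r) (hrr₁ : r ≤ r₁) :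
    ∫ s in (0 : ℝ)..r, w s ≤ ε * (1 + (Real.log r - Real.log (ε / a))) := by
  set rs : ℝ := ε / a with hrs
  have hrs0 : 0 < rs := div_pos hε ha
  have hr0 : 0 < r := hrs0.trans_le hr
  have hsplit : ∫ s in (0 : ℝ)..r, w s = (∫ s in (0 : ℝ)..rs, w s) + ∫ s in rs..r, w s :=
    (integral_add_adjacent_intervals (hw.intervalIntegrable _ _) (hw.intervalIntegrable _ _)).symm
  have h1 : ∫ s in (0 : ℝ)..rs, w s ≤ ε := by
    have h := hV rs ⟨hrs0, hr.trans hrr₁⟩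
    have e : rs * a = ε := by
      rw [hrs]
      field_simp
    linarith
  have hpos : ∀ s ∈ uIcc rs r, 0 < s := fun s hs => by
    rw [uIcc_of_le hr] at hs
    exact hrs0.trans_le hs.1
  have h2 : ∫ s in rs..r, w s ≤ ε * (Real.log r - Real.log rs) := by
    have hinv : IntervalIntegrable (fun s : ℝ => s⁻¹) volume rs r :=
      intervalIntegrable_inv (fun s hs => (hpos s hs).ne') continuousOn_id
    calc ∫ s in rs..r, w s ≤ ∫ s in rs..r, ε * s⁻¹ := by
          refine integral_mono_on hr (hw.intervalIntegrable _ _) (hinv.const_mul ε) fun s hs => ?_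
          have hs0 : 0 < s := hrs0.trans_le hs.1
          rw [← div_eq_mul_inv]
          exact hwε s ⟨hs0, hs.2.trans hrr₁⟩
      _ = ε * (Real.log r - Real.log rs) := by
          rw [intervalIntegral.integral_const_mul, integral_inv_of_pos hrs0 hr0,
            Real.log_div hr0.ne' hrs0.ne']
  rw [hsplit]
  linarith

/-- **(2.8) on `[δ, r₁]`**: under the same hypotheses, with `K ≥ 1` and `0 < r₁ ≤ εK/a`,
`∫_δ^{r₁} v(r)/r dr ≤ ε(1 + ln K + ½ (ln K)²)` for `0 < δ ≤ r₁`: on `(0, ε/a]` the integrand is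
`≤ a` (`v ≤ r a`), contributing `≤ ε`; on `[ε/a, r₁]` it is `≤ ε(1 + ln(ra/ε))/r`, whose
integral up to `εK/a` is `ε(ln K + ½ (ln K)²)` ("here we used `0 < r₁ ≤ εK(ε)/a(t)`"). With
`K = K(ε)` the right-hand side is `ε · ε^{-4/3} = ε^{-1/3}`. [cite: Wei2016, proof of Lemma 2.3, (2.8)] -/
theorem integral_primitive_mul_inv_le {w : ℝ → ℝ} {δ r₁ ε a K : ℝ} (hε : 0 < ε) (ha : 0 < a)
    (hK : 1 ≤ K) (hδ : 0 < δ) (hδr₁ : δ ≤ r₁) (hr₁K : r₁ ≤ ε * K / a) (hw : Continuous w)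
    (hwε : ∀ r ∈ Ioc 0 r₁, w r ≤ ε / r)
    (hV : ∀ r ∈ Ioc 0 r₁, ∫ s in (0 : ℝ)..r, w s ≤ r * a) :
    ∫ r in δ..r₁, (∫ s in (0 : ℝ)..r, w s) * r⁻¹ ≤
      ε * (1 + Real.log K + Real.log K ^ 2 / 2) := by
  have hr₁ : 0 < r₁ := hδ.trans_le hδr₁
  set V : ℝ → ℝ := fun r => ∫ s in (0 : ℝ)..r, w s with hVdef
  set rs : ℝ := ε / a with hrs
  have hrs0 : 0 < rs := div_pos hε ha
  have hrsa : rs * a = ε := by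
    rw [hrs]
    field_simp
  have hlogK : 0 ≤ Real.log K := Real.log_nonneg hK
  have hfinal : ε ≤ ε * (1 + Real.log K + Real.log K ^ 2 / 2) := by
    have : (1 : ℝ) ≤ 1 + Real.log K + Real.log K ^ 2 / 2 := by nlinarith [sq_nonneg (Real.log K)]
    nlinarith
  have hVcont : Continuous V := continuous_primitive (fun a b => hw.intervalIntegrable a b) 0
  -- the integrand is continuous on `[δ, r₁]` and bounded by `a` on `(0, r₁]`
  have hIcont : ∀ {c d : ℝ}, 0 < c → c ≤ d →
      IntervalIntegrable (fun r => V r * r⁻¹) volume c d := by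
    intro c d hc hcd
    refine (hVcont.continuousOn.mul (continuousOn_inv₀.mono ?_)).intervalIntegrable_of_Icc hcd
    intro r hr
    exact (hc.trans_le hr.1).ne'
  have hP1 : ∀ r ∈ Ioc 0 r₁, V r * r⁻¹ ≤ a := fun r hr => by
    rw [mul_inv_le_iff₀ hr.1]
    linarith [hV r hr]
  -- the part of the integral over `[c, d] ⊆ (0, r₁]` of length `≤ rs` is `≤ ε`
  have hshort : ∀ {c d : ℝ}, 0 < c → c ≤ d → d ≤ r₁ → d - c ≤ rs →
      ∫ r in c..d, V r * r⁻¹ ≤ ε := by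
    intro c d hc hcd hd hlen
    calc ∫ r in c..d, V r * r⁻¹ ≤ ∫ r in c..d, a :=
          integral_mono_on hcd (hIcont hc hcd) (continuous_const.intervalIntegrable _ _)
            fun r hr => hP1 r ⟨hc.trans_le hr.1, hr.2.trans hd⟩
      _ = (d - c) * a := by
          rw [intervalIntegral.integral_const, smul_eq_mul]
      _ ≤ rs * a := by gcongr
      _ = ε := hrsa
  by_cases hcase : r₁ ≤ rs
  · -- only the short part
    have h := hshort hδ hδr₁ le_rfl (by linarith)
    exact h.trans hfinal
  · push Not at hcase
    -- split at `m = max δ rs`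
    set m : ℝ := max δ rs with hm
    have hδm : δ ≤ m := le_max_left _ _
    have hrsm : rs ≤ m := le_max_right _ _
    have hmr₁ : m ≤ r₁ := max_le hδr₁ hcase.le
    have hm0 : 0 < m := hδ.trans_le hδm
    have hsplit : ∫ r in δ..r₁, V r * r⁻¹ =
        (∫ r in δ..m, V r * r⁻¹) + ∫ r in m..r₁, V r * r⁻¹ :=
      (integral_add_adjacent_intervals (hIcont hδ hδm) (hIcont hm0 hmr₁)).symm
    have h1 : ∫ r in δ..m, V r * r⁻¹ ≤ ε :=
      hshort hδ hδm hmr₁ (by rw [hm]; exact sub_le_iff_le_add.2 (max_le (by linarith) (by linarith)))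
    -- the logarithmic part: `V r / r ≤ ε (1 + ln r - ln rs)/r` on `[m, r₁]`
    have hGderiv : ∀ r : ℝ, 0 < r →
        HasDerivAt (fun r => (Real.log r - Real.log rs) + (Real.log r - Real.log rs) ^ 2 / 2)
          ((1 + (Real.log r - Real.log rs)) * r⁻¹) r := by
      intro r hr
      have hl : HasDerivAt (fun r => Real.log r - Real.log rs) r⁻¹ r :=
        (Real.hasDerivAt_log hr.ne').sub_const _
      have h := hl.fun_add ((hl.fun_pow 2).div_const 2)
      refine h.congr_deriv ?_
      rw [show (2 : ℕ) - 1 = 1 from rfl, pow_one, Nat.cast_ofNat]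
      ring
    set g : ℝ → ℝ := fun r => (1 + (Real.log r - Real.log rs)) * r⁻¹ with hg
    set G : ℝ → ℝ := fun r => (Real.log r - Real.log rs) + (Real.log r - Real.log rs) ^ 2 / 2
      with hG
    have hgcont : ContinuousOn g (Icc rs r₁) := by
      refine ContinuousOn.mul (continuousOn_const.add
        ((Real.continuousOn_log.mono ?_).sub continuousOn_const)) (continuousOn_inv₀.mono ?_)
      · intro r hr
        exact (hrs0.trans_le hr.1).ne'
      · intro r hr
        exact (hrs0.trans_le hr.1).ne'
    have hgint : IntervalIntegrable g volume rs r₁ := hgcont.intervalIntegrable_of_Icc hcase.le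
    have hgnonneg : ∀ r ∈ Icc rs r₁, 0 ≤ g r := by
      intro r hr
      have hr0 : 0 < r := hrs0.trans_le hr.1
      have : 0 ≤ Real.log r - Real.log rs := sub_nonneg.2 (Real.log_le_log hrs0 hr.1)
      simp only [hg]
      positivity
    have h2 : ∫ r in m..r₁, V r * r⁻¹ ≤ ε * ∫ r in rs..r₁, g r := by
      calc ∫ r in m..r₁, V r * r⁻¹ ≤ ∫ r in m..r₁, ε * g r := by
            refine integral_mono_on hmr₁ (hIcont hm0 hmr₁)
              ((hgint.mono_set ?_).const_mul ε) fun r hr => ?_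
            · rw [uIcc_of_le hmr₁, uIcc_of_le hcase.le]
              exact Icc_subset_Icc_left hrsm
            · have hr0 : 0 < r := hm0.trans_le hr.1
              have hVr := primitive_le_of_le_div hε ha hw hwε hV (hrsm.trans hr.1) hr.2
              simp only [hg]
              rw [← mul_assoc]
              exact mul_le_mul_of_nonneg_right hVr (inv_nonneg.2 hr0.le)
        _ = ε * ∫ r in m..r₁, g r := intervalIntegral.integral_const_mul _ _
        _ ≤ ε * ∫ r in rs..r₁, g r := by
            refine mul_le_mul_of_nonneg_left ?_ hε.le
            refine integral_mono_interval hrsm hmr₁ le_rfl ?_ hgint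
            filter_upwards [ae_restrict_mem measurableSet_Ioc] with r hr
            exact hgnonneg r ⟨hr.1.le, hr.2⟩
    have h3 : ∫ r in rs..r₁, g r = G r₁ - G rs :=
      integral_eq_sub_of_hasDerivAt (fun r hr => hGderiv r (by
        rw [uIcc_of_le hcase.le] at hr
        exact hrs0.trans_le hr.1)) hgint
    have hGrs : G rs = 0 := by
      simp only [hG, sub_self]
      norm_num
    -- `ln(r₁/rs) ≤ ln K`
    have hl : Real.log r₁ - Real.log rs ≤ Real.log K := by
      rw [← Real.log_div hr₁.ne' hrs0.ne']
      refine Real.log_le_log (div_pos hr₁ hrs0) ?_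
      rw [div_le_iff₀ hrs0, hrs]
      calc r₁ ≤ ε * K / a := hr₁K
        _ = K * (ε / a) := by ring
    have hl0 : 0 ≤ Real.log r₁ - Real.log rs := sub_nonneg.2 (Real.log_le_log hrs0 hcase.le)
    have hGr₁ : G r₁ ≤ Real.log K + Real.log K ^ 2 / 2 := by
      simp only [hG]
      nlinarith
    rw [hsplit]
    calc (∫ r in δ..m, V r * r⁻¹) + ∫ r in m..r₁, V r * r⁻¹
        ≤ ε + ε * (Real.log K + Real.log K ^ 2 / 2) := by
          refine add_le_add h1 (h2.trans ?_)
          rw [h3, hGrs, sub_zero]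
          exact mul_le_mul_of_nonneg_left hGr₁ hε.le
      _ = ε * (1 + Real.log K + Real.log K ^ 2 / 2) := by ring

/-! ### (2.5)–(2.6): the Hardy-type inequality along a ray -/

/-- **Wei 2016, Lemma 2.3, core estimate (2.5) along a ray.** Let `0 < ε`, `0 < a`, `1 ≤ K`,
`0 < r₁ ≤ εK/a`; let `w ≥ 0` be continuous (the profile `r ↦ |u_θ(r, z, t)|`) with
`w(r) ≤ ε/r` and `v(r) = ∫₀ʳ w ≤ r a` for `0 < r ≤ r₁` (i.e. `|Γ| ≤ ε` on `r ≤ r₁` and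
`a ≥ ‖v/r‖_∞`); let `f` be differentiable with continuous derivative and `f(r₁) = 0`. Then
`∫₀^{r₁} w f² dr ≤ ε(1 + ln K + ½ (ln K)²) ∫₀^{r₁} r f'(r)² dr`.
With `K = K(ε)` (`1 + ln K + ½ (ln K)² = ε^{-4/3}`) this is the printed
`∫ |u_θ(r', z, t)| |f(r', z)|² dr' ≤ ε^{-1/3} ∫ r |∂ᵣf|² dr`, which integrated in `z` gives (2.5).
Proof: on `[δ, r₁]`, `w f² ≤ w · D ln(r₁/r)` with `D = ∫₀^{r₁} r f'²`
(`sq_le_integral_mul_log`), `∫_δ^{r₁} w ln(r₁/r) ≤ ∫_δ^{r₁} v/r`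
(`integral_mul_log_le_integral_primitive_mul_inv`) `≤ ε(1 + ln K + ½ (ln K)²)`
(`integral_primitive_mul_inv_le`); then `δ → 0⁺`. [cite: Wei2016, Lemma 2.3, proof, (2.5)–(2.8)] -/
theorem integral_mul_sq_le_hardy {w f f' : ℝ → ℝ} {ε a r₁ K : ℝ} (hε : 0 < ε) (ha : 0 < a)
    (hK : 1 ≤ K) (hr₁ : 0 < r₁) (hr₁K : r₁ ≤ ε * K / a) (hw : Continuous w) (hw0 : ∀ r, 0 ≤ w r)
    (hwε : ∀ r ∈ Ioc 0 r₁, w r ≤ ε / r) (hV : ∀ r ∈ Ioc 0 r₁, ∫ s in (0 : ℝ)..r, w s ≤ r * a)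
    (hf : ∀ r, HasDerivAt f (f' r) r) (hf' : Continuous f') (hfr₁ : f r₁ = 0) :
    ∫ r in (0 : ℝ)..r₁, w r * f r ^ 2 ≤
      ε * (1 + Real.log K + Real.log K ^ 2 / 2) * ∫ r in (0 : ℝ)..r₁, r * f' r ^ 2 := by
  set D : ℝ := ∫ r in (0 : ℝ)..r₁, r * f' r ^ 2 with hDdef
  set M : ℝ := ε * (1 + Real.log K + Real.log K ^ 2 / 2) with hMdef
  have hfc : Continuous f := continuous_iff_continuousAt.2 fun r => (hf r).continuousAt
  have hsqint : IntervalIntegrable (fun r : ℝ => r * f' r ^ 2) volume 0 r₁ :=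
    (continuous_id.mul (hf'.pow 2)).intervalIntegrable _ _
  have hD0 : 0 ≤ D := intervalIntegral.integral_nonneg hr₁.le fun r hr => by
    have : 0 ≤ r := hr.1
    positivity
  -- the estimate on `[δ, r₁]`
  have hδbound : ∀ δ ∈ Ioo 0 r₁, ∫ r in δ..r₁, w r * f r ^ 2 ≤ M * D := by
    intro δ hδ
    have hsub : ∀ r ∈ Icc δ r₁, (∫ s in r..r₁, s * f' s ^ 2) ≤ D := by
      intro r hr
      refine integral_mono_interval (hδ.1.le.trans hr.1) hr.2 le_rfl ?_ hsqint
      filter_upwards [ae_restrict_mem measurableSet_Ioc] with s hs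
      have : 0 ≤ s := hs.1.le
      positivity
    have hlogcont : ContinuousOn (fun r => Real.log (r₁ / r)) (Icc δ r₁) := by
      refine (Real.continuousOn_log.comp (continuousOn_const.div continuousOn_id fun r hr => ?_)
        fun r hr => ?_)
      · exact (hδ.1.trans_le hr.1).ne'
      · exact (div_pos hr₁ (hδ.1.trans_le hr.1)).ne'
    have step1 : ∫ r in δ..r₁, w r * f r ^ 2 ≤ ∫ r in δ..r₁, w r * (D * Real.log (r₁ / r)) := by
      refine integral_mono_on hδ.2.le ((hw.mul (hfc.pow 2)).intervalIntegrable _ _)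
        ((hw.continuousOn.mul (continuousOn_const.mul hlogcont)).intervalIntegrable_of_Icc hδ.2.le)
        fun r hr => ?_
      have hr0 : 0 < r := hδ.1.trans_le hr.1
      refine mul_le_mul_of_nonneg_left ?_ (hw0 r)
      have hlog0 : 0 ≤ Real.log (r₁ / r) := Real.log_nonneg ((one_le_div hr0).2 hr.2)
      exact (sq_le_integral_mul_log hr0 hr.2 hf hf' hfr₁).trans
        (mul_le_mul_of_nonneg_right (hsub r hr) hlog0)
    have step2 : ∫ r in δ..r₁, w r * (D * Real.log (r₁ / r)) =
        D * ∫ r in δ..r₁, w r * Real.log (r₁ / r) := by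
      rw [← intervalIntegral.integral_const_mul]
      refine integral_congr fun r _ => ?_
      ring
    have step3 := integral_mul_log_le_integral_primitive_mul_inv hδ.1 hδ.2.le hw hw0
    have step4 := integral_primitive_mul_inv_le hε ha hK hδ.1 hδ.2.le hr₁K hw hwε hV
    calc ∫ r in δ..r₁, w r * f r ^ 2 ≤ D * ∫ r in δ..r₁, w r * Real.log (r₁ / r) := by
          rw [← step2]
          exact step1
      _ ≤ D * ∫ r in δ..r₁, (∫ s in (0 : ℝ)..r, w s) * r⁻¹ := mul_le_mul_of_nonneg_left step3 hD0
      _ ≤ D * M := mul_le_mul_of_nonneg_left step4 hD0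
      _ = M * D := mul_comm _ _
  -- `δ → 0⁺`
  have hcontP : Continuous fun δ => ∫ r in δ..r₁, w r * f r ^ 2 := by
    have hc : Continuous fun r => w r * f r ^ 2 := hw.mul (hfc.pow 2)
    have h := (continuous_primitive (μ := volume) (fun a b => hc.intervalIntegrable a b) r₁).neg
    convert h using 1
    funext δ
    simp only [Pi.neg_apply, integral_symm r₁ δ]
  have htend : Tendsto (fun δ => ∫ r in δ..r₁, w r * f r ^ 2) (𝓝[>] 0)
      (𝓝 (∫ r in (0 : ℝ)..r₁, w r * f r ^ 2)) :=
    (hcontP.tendsto 0).mono_left nhdsWithin_le_nhds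
  refine le_of_tendsto htend ?_
  filter_upwards [Ioo_mem_nhdsGT hr₁] with δ hδ using hδbound δ hδ

end Wei2016

end Literature.Analysis.FluidPDE

end
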